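import Literature.Computability.Cryptography.LWESwitchKernelProg
import Literature.Computability.Cryptography.LWESwitchMachineKernel
import Literature.Computability.Cryptography.LWEPrimePowerProgData
import Literature.Computability.Cryptography.SamplerCoinLaws
import HarnessLib

/-!
# The h₃ machine's kernel program on uniform coins has the law `machSamplePMF`

Topic `Computability/Cryptography` (LWE), grouping namespace `BLPRS2013.KProg`; bridge between the PROGRAM of
`LWESwitchKernelProg.lean` (`kernelFlat`: one switched sample as a deterministic function of the shift `t`, the input sample
`(a, b̄)` and a flat coin string) and the LAW of `LWESwitchMachineKernel.lean` (`machSamplePMF`: `kⱼ ← rejLaw`, cell `k_P` uniform,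
`G ← ℓ'`, then the arithmetic). On a uniform coin string long enough, the program's output IS a sample of `machSamplePMF` (read
through the residues-as-naturals encoding `LWE.MP12.Prog.toItem` of `LWEPrimePowerProgData.lean`, the list form of the tree's sample code).
Everything PROVED; definitions with bodies (`encT`, `outOf`); no named fact.

* `chunk_append_left`, `chunkList_eq_ofFn`, `zipWith_ofFn_ofFn` (list plumbing); `toNat_emod_eq_val`, `machValue_eq_round_zRat`,
  `toItem_injective`, **`outOf_eq_toItem`** (the program's arithmetic is the recipe's, through the encoding);
* **`kernelFlat_eq_outOf`** (on genuine inputs the program is the assembly `outOf` of the three ingredients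
  `(k, k_P, G)` read off the coins);
* **`uniformVector_map_ingredients`** (under uniform coins the ingredients are INDEPENDENT with laws `⨂ⱼ rejLaw θ (qaⱼ/Q) …`,
  `U[0,2ᴾ)`, `ℓ'` — `vecSplit`, `uniformVector_map_chunks_eq_indepLaw`, `uniformVector_map_rejFlat`, `vecNum`,
  `uniformVector_map_samplerFlat_eq_lawPMF`);
* **`uniformVector_map_kernelFlat`** — `(U {0,1}^{C₀}).map (kernelFlat … t a b̄) = (machSamplePMF …).map toItem` for
  `C₀ ≥ nC + P + coinLen`, `C = R(w+1+P_r)`.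

## References

* Z. Brakerski, A. Langlois, C. Peikert, O. Regev, D. Stehlé, *Classical hardness of learning with errors*, STOC 2013;
  arXiv:1306.0281, Lemma 3.5 / Cor. 3.2 (the map) and §5. [BrakerskiEtAl2013]
* S. Arora, B. Barak, *Computational Complexity: A Modern Approach*, CUP 2009, Def. 7.1 (the coins of a probabilistic
  machine form ONE uniform string). [AroraBarak2009]
-/

noncomputable section

open scoped ENNReal
open PMF Literature.Probability.Distributions Literature.Algebra.EuclideanLattices Literature.Computability.Complexity

namespace Literature.Computability.Cryptography

namespace BLPRS2013

namespace KProg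

open GaussRejMachine

/-! ### List plumbing -/

/-- A chunk inside the left part of an append is a chunk of the left part. [folklore] -/
theorem chunk_append_left (K : ℕ) {l₁ : List Bool} (l₂ : List Bool) {i : ℕ} (h : K * (i + 1) ≤ l₁.length) :
    chunk K (l₁ ++ l₂) i = chunk K l₁ i := by
  unfold chunk
  rw [List.drop_append_of_le_length (by nlinarith), List.take_append_of_le_length]
  rw [List.length_drop]
  have : K * (i + 1) = K * i + K := by ring
  omega

/-- The program's list of chunks is the family `chunk`. [folklore] -/
theorem chunkList_eq_ofFn (C n : ℕ) (coins : List Bool) :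
    ((List.range n).map fun j => (coins.drop (j * C)).take C) = List.ofFn fun j : Fin n => chunk C coins j := by
  apply List.ext_getElem
  · simp
  · intro i h₁ h₂
    simp [chunk, Nat.mul_comm]

/-- `zipWith` of two `ofFn`s. [folklore] -/
theorem zipWith_ofFn_ofFn {α β γ : Type*} {n : ℕ} (f : α → β → γ) (a : Fin n → α) (g : Fin n → β) :
    List.zipWith f (List.ofFn a) (List.ofFn g) = List.ofFn fun j => f (a j) (g j) := by
  apply List.ext_getElem
  · simp
  · intro i h₁ h₂
    simp

/-! ### The arithmetic of the program is the recipe's -/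

section Arith

variable {q : ℕ} [NeZero q]

/-- `(k mod q).toNat = val(k̄)`. [folklore] -/
theorem toNat_emod_eq_val (k : ℤ) : (k % (q : ℤ)).toNat = (k : ZMod q).val := by
  have h : ((k : ZMod q).val : ℤ) = k % (q : ℤ) := ZMod.val_intCast k
  rw [← h, Int.toNat_natCast]

/-- `((k mod q).toNat : ZMod q) = k̄`. [folklore] -/
theorem natCast_toNat_emod (k : ℤ) : (((k % (q : ℤ)).toNat : ℕ) : ZMod q) = (k : ZMod q) := by
  rw [toNat_emod_eq_val, ZMod.natCast_zmod_val]

end Arith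

section Sample

variable {n Q q' : ℕ} [NeZero Q] [NeZero q'] (θ : ℚ) (s N Pr w R : ℕ) (κh : ℚ) (b P : ℕ) (PG : PGParams)

omit [NeZero q'] in
/-- **The machine's rounded value is `⌊zRat⌉`** (the real expression of `machValue` is the rational `zRat`).
[cite: BrakerskiEtAl2013, Cor. 3.2 (the rounding) with §5] -/
theorem machValue_eq_round_zRat (bbar : ZMod Q) (kP : ℕ) (G : ℤ) :
    machValue Q q' ((centre Q q' bbar : ℚ) : ℝ) (κh : ℝ) b P kP G = round (zRat q' Q κh b P bbar.val kP G) := by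
  have hQ : (Q : ℝ) ≠ 0 := by exact_mod_cast NeZero.ne Q
  rw [machValue, ← Rat.round_cast (α := ℝ)]
  congr 1
  rw [zRat, cRat, centre]
  push_cast
  field_simp
  ring

variable (t : Fin n → ZMod q')

/-- The shift as residues. [folklore] -/
def encT : List ℕ := List.ofFn fun j => (t j).val

/-- The list form `toItem` of a sample is injective (`q' ≥ 1`). [folklore] -/
theorem toItem_injective : Function.Injective (LWE.MP12.Prog.toItem (d := n) (Q := q')) := by
  intro y y' h
  simp only [LWE.MP12.Prog.toItem, Prod.mk.injEq, List.ofFn_inj] at h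
  exact Prod.ext (funext fun j => ZMod.val_injective _ (congrFun h.1 j)) (ZMod.val_injective _ h.2)

/-- **The assembly of the output from the ingredients** `(k, k_P, G)`, as the program does it.
[cite: BrakerskiEtAl2013, Lemma 3.5 (the map) with §5] -/
def outOf (bbar : ZMod Q) (k : Fin n → ℤ) (kP : ℕ) (G : ℤ) : List ℕ × ℕ :=
  let a' := List.ofFn fun j => (k j % (q' : ℤ)).toNat
  (a', (((List.zipWith (fun x y : ℕ => ((x * y : ℕ) : ℤ)) a' (encT t)).sum + round (zRat q' Q κh b P bbar.val kP G)) % (q' : ℤ)).toNat)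

/-- **The program's arithmetic is the recipe's**: `outOf = toItem (k̄, ⟨k̄, t⟩ + machValue … k_P G)`.
[cite: BrakerskiEtAl2013, Lemma 3.5 (the map)] -/
theorem outOf_eq_toItem (bbar : ZMod Q) (k : Fin n → ℤ) (kP : ℕ) (G : ℤ) :
    outOf (Q := Q) κh b P t bbar k kP G =
      LWE.MP12.Prog.toItem ((fun j => (k j : ZMod q')),
        (fun j => (k j : ZMod q')) ⬝ᵥ t + ((machValue Q q' ((centre Q q' bbar : ℚ) : ℝ) (κh : ℝ) b P kP G : ℤ) : ZMod q')) := by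
  unfold outOf LWE.MP12.Prog.toItem
  simp only [Prod.mk.injEq]
  constructor
  · exact List.ofFn_inj.2 (funext fun j => toNat_emod_eq_val (k j))
  · rw [toNat_emod_eq_val, machValue_eq_round_zRat]
    congr 1
    -- the dot product: `Σ ((kⱼ mod q).toNat · val tⱼ : ℤ) ≡ ⟨k̄, t⟩`
    rw [encT, zipWith_ofFn_ofFn, List.sum_ofFn, dotProduct]
    push_cast
    congr 1
    refine Finset.sum_congr rfl fun j _ => ?_
    rw [natCast_toNat_emod, ZMod.natCast_zmod_val]

/-! ### The program is the assembly of the ingredients read off the coins -/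

omit [NeZero Q] [NeZero q'] in
/-- **On genuine inputs the program is `outOf` of the three ingredients read off the coins** (`C = R(w+1+P_r)`).
[cite: BrakerskiEtAl2013, §5; AroraBarak2009, Def. 7.1] -/
theorem kernelFlat_eq_outOf (p : (Fin n → ZMod Q) × ZMod Q) (coins : List Bool) :
    kernelFlat θ s N Pr w R q' Q κh b P PG (encT t) (List.ofFn fun j => (p.1 j).val) p.2.val coins =
      outOf (Q := Q) κh b P t p.2
        (fun j => rejFlat θ (cRat q' Q (p.1 j).val) s N Pr w R (chunk (R * (w + 1 + Pr)) coins j))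
        (bitsToNat ((coins.drop (n * (R * (w + 1 + Pr)))).take P))
        (PG.samplerFlat (((coins.drop (n * (R * (w + 1 + Pr)))).drop P).take PG.coinLen)) := by
  unfold kernelFlat outOf
  simp only [List.length_ofFn, chunkList_eq_ofFn, zipWith_ofFn_ofFn, List.map_ofFn]
  rfl

/-! ### The law of the ingredients under uniform coins -/

omit [NeZero Q] [NeZero q'] in
/-- **The three ingredients are independent with the laws `⨂ⱼ rejLaw θ (qaⱼ/Q) …`, `U[0,2ᴾ)` (as naturals), `ℓ'`** when read off a
uniform string of length `C₀ ≥ nC + P + coinLen`. [cite: AroraBarak2009, Def. 7.1; BrakerskiEtAl2013, §5] -/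
theorem uniformVector_map_ingredients (a : Fin n → ZMod Q) {C₀ : ℕ} (hC₀ : n * (R * (w + 1 + Pr)) + (P + PG.coinLen) ≤ C₀) :
    (uniformOfFintype (List.Vector Bool C₀)).map (fun v =>
      ((fun j => rejFlat θ (cRat q' Q (a j).val) s N Pr w R (chunk (R * (w + 1 + Pr)) v.toList j)),
        bitsToNat ((v.toList.drop (n * (R * (w + 1 + Pr)))).take P),
        PG.samplerFlat (((v.toList.drop (n * (R * (w + 1 + Pr)))).drop P).take PG.coinLen))) =
      (indepLaw n fun j => GaussRej.rejLaw θ (cRat q' Q (a j).val) s N Pr w R).bind fun k =>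
        (uniformOfFintype (Fin (2 ^ P))).bind fun kP => PG.lawPMF.map fun G => (k, (kP : ℕ), G) := by
  classical
  set C := R * (w + 1 + Pr) with hCdef
  have h1 : n * C ≤ C₀ := by omega
  -- split at `nC`
  set f₁ : List.Vector Bool (n * C) → (Fin n → ℤ) := fun v₁ j => rejFlat θ (cRat q' Q (a j).val) s N Pr w R (chunk C v₁.toList j) with hf₁
  set h₂ : List.Vector Bool (C₀ - n * C) → ℕ × ℤ := fun v₂ =>
    (bitsToNat (v₂.toList.take P), PG.samplerFlat ((v₂.toList.drop P).take PG.coinLen)) with hh₂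
  have hfac : (fun v : List.Vector Bool C₀ =>
      ((fun j => rejFlat θ (cRat q' Q (a j).val) s N Pr w R (chunk C v.toList j)),
        bitsToNat ((v.toList.drop (n * C)).take P),
        PG.samplerFlat (((v.toList.drop (n * C)).drop P).take PG.coinLen))) =
      (fun pr : List.Vector Bool (n * C) × List.Vector Bool (C₀ - n * C) => (f₁ pr.1, h₂ pr.2)) ∘ vecSplit (n * C) C₀ h1 := by
    funext v
    simp only [Function.comp_apply, vecSplit, Equiv.coe_fn_mk, hf₁, hh₂, List.Vector.toList_mk]
    refine Prod.ext (funext fun j => ?_) rfl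
    simp only
    congr 1
    conv_lhs => rw [← List.take_append_drop (n * C) v.toList]
    rw [chunk_append_left]
    rw [List.length_take, List.Vector.toList_length, min_eq_left h1]
    exact (Nat.mul_le_mul_left C j.2).trans (le_of_eq (Nat.mul_comm C n))
  rw [hfac, ← PMF.map_comp, uniformVector_map_vecSplit, uniformOfFintype_prod_eq_bind, PMF.map_bind]
  simp only [PMF.map_comp, Function.comp_def]
  -- the first factor: chunks then flat samplers
  have hk : (uniformOfFintype (List.Vector Bool (n * C))).map f₁ =
      indepLaw n fun j => GaussRej.rejLaw θ (cRat q' Q (a j).val) s N Pr w R := by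
    have hch : f₁ = (fun c j => rejFlat θ (cRat q' Q (a j).val) s N Pr w R (c j).toList) ∘ chunks C n (le_of_eq (Nat.mul_comm C n)) := by
      funext v₁; rfl
    rw [hch, ← PMF.map_comp, uniformVector_map_chunks_eq_indepLaw,
      indepLaw_map_pi n _ (fun j (c : List.Vector Bool C) => rejFlat θ (cRat q' Q (a j).val) s N Pr w R c.toList)]
    congr 1
    funext j
    exact uniformVector_map_rejFlat θ (cRat q' Q (a j).val) s N Pr w R le_rfl
  -- the second factor: `P` bits then the sampler's coins
  have hP : P ≤ C₀ - n * C := by omega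
  have hrest : (uniformOfFintype (List.Vector Bool (C₀ - n * C))).map h₂ =
      (uniformOfFintype (Fin (2 ^ P))).bind fun kP => PG.lawPMF.map fun G => ((kP : ℕ), G) := by
    have hfac₂ : h₂ = (fun pr : List.Vector Bool P × List.Vector Bool (C₀ - n * C - P) =>
        (bitsToNat pr.1.toList, PG.samplerFlat (pr.2.toList.take PG.coinLen))) ∘ vecSplit P (C₀ - n * C) hP := by
      funext v₂; rfl
    rw [hfac₂, ← PMF.map_comp, uniformVector_map_vecSplit, uniformOfFintype_prod_eq_bind, PMF.map_bind]
    try simp only [PMF.map_comp, Function.comp_def]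
    -- `P` uniform bits read as a number: uniform on `[0, 2ᴾ)`
    have hnum : (uniformOfFintype (List.Vector Bool P)).map (fun u => bitsToNat u.toList) =
        (uniformOfFintype (Fin (2 ^ P))).map (fun kP : Fin (2 ^ P) => kP.val) := by
      rw [← uniformOfFintype_map_equiv (Equiv.ofBijective _ (vecNum_bijective P)), PMF.map_comp]
      rfl
    -- the sampler's coins: the first `coinLen` of the rest
    have hL : PG.coinLen ≤ C₀ - n * C - P := by omega
    have hsam : (uniformOfFintype (List.Vector Bool (C₀ - n * C - P))).map (fun v₃ => PG.samplerFlat (v₃.toList.take PG.coinLen)) = PG.lawPMF := by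
      have hfac₃ : (fun v₃ : List.Vector Bool (C₀ - n * C - P) => PG.samplerFlat (v₃.toList.take PG.coinLen)) =
          (fun pr : List.Vector Bool PG.coinLen × List.Vector Bool (C₀ - n * C - P - PG.coinLen) => PG.samplerFlat pr.1.toList) ∘
            vecSplit PG.coinLen _ hL := by
        funext v₃; rfl
      rw [hfac₃, ← PMF.map_comp, uniformVector_map_vecSplit, uniformOfFintype_prod_eq_bind, PMF.map_bind]
      have : ∀ u : List.Vector Bool PG.coinLen,
          ((uniformOfFintype (List.Vector Bool (C₀ - n * C - P - PG.coinLen))).map (Prod.mk u)).map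
              (fun pr : List.Vector Bool PG.coinLen × List.Vector Bool (C₀ - n * C - P - PG.coinLen) => PG.samplerFlat pr.1.toList) =
            PMF.pure (PG.samplerFlat u.toList) := fun u => by
        rw [PMF.map_comp]
        exact PMF.map_const _ (PG.samplerFlat u.toList)
      simp_rw [this]
      rw [show (fun u : List.Vector Bool PG.coinLen => PMF.pure (PG.samplerFlat u.toList)) =
        PMF.pure ∘ (fun u : List.Vector Bool PG.coinLen => PG.samplerFlat u.toList) from rfl, PMF.bind_pure_comp]
      exact PGParams.uniformVector_map_samplerFlat_eq_lawPMF PG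
    -- assemble the pair `(k_P, G)`
    calc ((uniformOfFintype (List.Vector Bool P)).bind fun u =>
          (uniformOfFintype (List.Vector Bool (C₀ - n * C - P))).map fun v₃ => (bitsToNat u.toList, PG.samplerFlat (v₃.toList.take PG.coinLen)))
        = (uniformOfFintype (List.Vector Bool P)).bind fun u =>
            ((uniformOfFintype (List.Vector Bool (C₀ - n * C - P))).map fun v₃ => PG.samplerFlat (v₃.toList.take PG.coinLen)).map
              fun G => (bitsToNat u.toList, G) := by simp only [PMF.map_comp, Function.comp_def]
      _ = (uniformOfFintype (List.Vector Bool P)).bind fun u => PG.lawPMF.map fun G => (bitsToNat u.toList, G) := by rw [hsam]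
      _ = ((uniformOfFintype (List.Vector Bool P)).map fun u => bitsToNat u.toList).bind fun kP => PG.lawPMF.map fun G => (kP, G) := by
          rw [PMF.bind_map]; rfl
      _ = (uniformOfFintype (Fin (2 ^ P))).bind fun kP => PG.lawPMF.map fun G => ((kP : ℕ), G) := by
          rw [hnum, PMF.bind_map]; rfl
  -- assemble
  calc ((uniformOfFintype (List.Vector Bool (n * C))).bind fun v₁ =>
        (uniformOfFintype (List.Vector Bool (C₀ - n * C))).map fun v₂ => (f₁ v₁, h₂ v₂))
      = (uniformOfFintype (List.Vector Bool (n * C))).bind fun v₁ =>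
          ((uniformOfFintype (List.Vector Bool (C₀ - n * C))).map h₂).map fun y => (f₁ v₁, y) := by
        simp only [PMF.map_comp, Function.comp_def]
    _ = ((uniformOfFintype (List.Vector Bool (n * C))).map f₁).bind fun k =>
          ((uniformOfFintype (List.Vector Bool (C₀ - n * C))).map h₂).map fun y => (k, y) := by
        rw [PMF.bind_map]; rfl
    _ = (indepLaw n fun j => GaussRej.rejLaw θ (cRat q' Q (a j).val) s N Pr w R).bind fun k =>
          (uniformOfFintype (Fin (2 ^ P))).bind fun kP => PG.lawPMF.map fun G => (k, (kP : ℕ), G) := by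
        rw [hk, hrest]
        congr 1
        funext k
        rw [PMF.map_bind]
        simp only [PMF.map_comp, Function.comp_def]

/-! ### The law of the program -/

/-- **On uniform coins the kernel program samples `machSamplePMF`** (read through the residue encoding), for coin strings
of length `C₀ ≥ nC + P + coinLen`. [cite: BrakerskiEtAl2013, Cor. 3.2 / Lemma 3.5 (the map) with §5; AroraBarak2009, Def. 7.1] -/
theorem uniformVector_map_kernelFlat (p : (Fin n → ZMod Q) × ZMod Q) {C₀ : ℕ} (hC₀ : n * (R * (w + 1 + Pr)) + (P + PG.coinLen) ≤ C₀) :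
    (uniformOfFintype (List.Vector Bool C₀)).map (fun v =>
      kernelFlat θ s N Pr w R q' Q κh b P PG (encT t) (List.ofFn fun j => (p.1 j).val) p.2.val v.toList) =
      (machSamplePMF n Q q' θ s N Pr w R κh b P PG.lawPMF t p).map (LWE.MP12.Prog.toItem (d := n) (Q := q')) := by
  have hker : (fun v : List.Vector Bool C₀ =>
      kernelFlat θ s N Pr w R q' Q κh b P PG (encT t) (List.ofFn fun j => (p.1 j).val) p.2.val v.toList) =
      (fun y : (Fin n → ℤ) × ℕ × ℤ => outOf (Q := Q) κh b P t p.2 y.1 y.2.1 y.2.2) ∘ (fun v =>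
        ((fun j => rejFlat θ (cRat q' Q (p.1 j).val) s N Pr w R (chunk (R * (w + 1 + Pr)) v.toList j)),
          bitsToNat ((v.toList.drop (n * (R * (w + 1 + Pr)))).take P),
          PG.samplerFlat (((v.toList.drop (n * (R * (w + 1 + Pr)))).drop P).take PG.coinLen))) := by
    funext v
    exact kernelFlat_eq_outOf θ s N Pr w R κh b P PG t p v.toList
  rw [hker, ← PMF.map_comp, uniformVector_map_ingredients θ s N Pr w R P PG p.1 hC₀, PMF.map_bind]
  have hc : ∀ j, cRat q' Q (p.1 j).val = centre Q q' (p.1 j) := fun j => by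
    unfold cRat centre; push_cast; ring
  simp only [hc]
  rw [machSamplePMF, PMF.map_bind]
  congr 1
  funext k
  rw [PMF.map_bind, coinRoundLaw, PMF.map_bind, PMF.map_bind, PMF.map_bind]
  congr 1
  funext kP
  simp only [PMF.map_comp, Function.comp_def]
  congr 1
  funext G
  exact outOf_eq_toItem κh b P t p.2 k kP G

end Sample

end KProg

end BLPRS2013

end Literature.Computability.Cryptography

end
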